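import Literature.AlgebraicGeometry.Resolution.BlowupDisjointCentreSplitting
import Literature.AlgebraicGeometry.Resolution.KollarTripleBlowup
import HarnessLib

/-!
# [OURS · L1 W4.5(b) · EL♮(3) · D4-0e] DENSITY LEMMAS: the complement of the exceptional locus of a blow-up is dense, so the «strict transform of the
# whole stage» `closure (υ⁻¹(univ ∖ W))` is the whole blow-up

Cell `res-hironaka`, crux EL♮(3) `EquisingularLiftNatThree` (stmt-ResolutionOfSingularities-20148), chain W4.5b, line `sections`; desk DEAL D4-0e
(2026-08-28T19:00Z, crit-3 (U1)) to res-L1-w45b-iso-w1 g2.  OURS; NOT a statement of any manuscript; nothing of [Hironaka2017] is asserted; AI-written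
kernel bookkeeping, weaker than expert review.  Def-free, `sorry`-free, standard axioms.  `--kind proof --supports stmt-ResolutionOfSingularities-20148 --as helper`.

WHY.  In the hosted-nose by-inclusion proof `NoseHypPointsFirstBTriplePrime → NoseHypHostedNest…` (WIDTH TABLE D4, res-L1-w45b-stub-2 / res-type-027) the host
surface of a point step transforms as `St E₁ := closure (υ⁻¹(E₁ ∖ {ι x}))`; when the host is the whole stage (`E₁ = univ`) this must rewrite to `univ`.  In the
reach currency every centre is REDUCED: `IsBlowup υ (vanishingIdeal ⟨W, hW⟩)`.

CONTENTS (namespace `…Cruxes.EquisingularLiftNat.Sections`; all over `{X X' : Scheme} (υ : X' ⟶ X) {W : Set X} (hW : IsClosed W)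
(hυ : IsBlowup υ (vanishingIdeal ⟨W, hW⟩))`):
* `preimage_eq_support_comap_of_isBlowup` — `υ⁻¹ W` is the support of the exceptional ideal `(vanishingIdeal ⟨W,hW⟩).comap υ` (Mathlib `support_comap`).
* ★ `dense_preimage_compl_of_isBlowup` — `[IsLocallyNoetherian X]`: `υ⁻¹(Wᶜ)` is DENSE in `X′` (the exceptional locus is an effective Cartier divisor,
  `IsBlowup.isEffectiveCartier`; its complement is dense on the locally Noetherian `X′`, Literature ✓ `IsEffectiveCartier.dense_compl_support` (GW Rem. 9.24) +
  ✓ `IsBlowup.isLocallyNoetherian` (Stacks 02NS)).  NO integrality / irreducibility of the stage is needed.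
* ★ `closure_preimage_univ_diff_of_isBlowup` — `closure (υ ⁻¹' (Set.univ \ W)) = Set.univ`; rewriting forms `closure_preimage_diff_of_isBlowup_of_eq_univ`
  (`E = univ ⇒ closure (υ ⁻¹' (E \ W)) = univ`, the shape of `St E₁` at a point/curve step) and `closure_compl_preimage_of_isBlowup` (`closure (υ ⁻¹' W)ᶜ = univ`);
  the point-centre instance `closure_preimage_univ_diff_singleton_of_isBlowup` (`W = {x}`).
* `closure_preimage_univ_diff_of_isBlowup_of_irreducibleSpace` — the Noetherian-free variant for an IRREDUCIBLE blow-up and a centre `W ≠ univ` (a non-empty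
  open subset of an irreducible space is dense; non-emptiness by the isomorphism `υ ∣_ Wᶜ`, ✓ `IsBlowup.isIso_morphismRestrict_compl_of_vanishingIdeal`).

HONEST SCOPE.  Scheme bookkeeping only; EL♮(3) is NOT proved here; dim-3 char-p resolution is a theorem in print (Cossart–Piltant 2008/2009); counted 0.
-/

set_option linter.dupNamespace false

noncomputable section

open CategoryTheory AlgebraicGeometry TopologicalSpace Topology
open Literature.AlgebraicGeometry.Resolution
open AlgebraicGeometry.Scheme.IdealSheafData

namespace Summit.ResolutionOfSingularities.ResolutionOfSingularities.Cruxes.EquisingularLiftNat.Sections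

variable {X X' : Scheme.{0}} (υ : X' ⟶ X) {W : Set X} (hW : IsClosed W)

/-- The exceptional locus `υ⁻¹ W` is the support of the pulled-back centre ideal. [OURS · bookkeeping] -/
theorem preimage_eq_support_comap_of_isBlowup :
    υ ⁻¹' W = (((vanishingIdeal (⟨W, hW⟩ : Closeds X)).comap υ).support : Set X') := by
  rw [support_comap, Closeds.coe_preimage, Scheme.IdealSheafData.coe_support_vanishingIdeal]
  rfl

/-- ★ **The complement of the exceptional locus of a blow-up is dense** (`X` locally Noetherian; any reduced centre `W`): the exceptional locus is an
effective Cartier divisor of the locally Noetherian `X′`, whose complement is dense. [OURS · L1 W4.5b · D4-0e] -/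
theorem dense_preimage_compl_of_isBlowup [IsLocallyNoetherian X] (hυ : IsBlowup υ (vanishingIdeal (⟨W, hW⟩ : Closeds X))) :
    Dense (υ ⁻¹' Wᶜ) := by
  haveI : IsLocallyNoetherian X' := hυ.isLocallyNoetherian
  have h := hυ.isEffectiveCartier.dense_compl_support
  rw [← preimage_eq_support_comap_of_isBlowup υ hW] at h
  rwa [Set.preimage_compl]

/-- ★ **`closure (υ⁻¹(univ ∖ W)) = univ`** — the «strict transform of the whole stage» under a blow-up of the reduced centre `W` is the whole blow-up
(`X` locally Noetherian). [OURS · L1 W4.5b · D4-0e] -/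
theorem closure_preimage_univ_diff_of_isBlowup [IsLocallyNoetherian X] (hυ : IsBlowup υ (vanishingIdeal (⟨W, hW⟩ : Closeds X))) :
    closure (υ ⁻¹' (Set.univ \ W)) = Set.univ := by
  rw [Set.sdiff_eq, Set.univ_inter]
  exact (dense_preimage_compl_of_isBlowup υ hW hυ).closure_eq

/-- Rewriting form: if the host is the whole stage, `E = univ`, then `closure (υ⁻¹(E ∖ W)) = univ`. [OURS · L1 W4.5b · D4-0e] -/
theorem closure_preimage_diff_of_isBlowup_of_eq_univ [IsLocallyNoetherian X] (hυ : IsBlowup υ (vanishingIdeal (⟨W, hW⟩ : Closeds X)))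
    {E : Set X} (hE : E = Set.univ) : closure (υ ⁻¹' (E \ W)) = Set.univ := by
  rw [hE]
  exact closure_preimage_univ_diff_of_isBlowup υ hW hυ

/-- Rewriting form: `closure ((υ⁻¹ W)ᶜ) = univ`. [OURS · L1 W4.5b · D4-0e] -/
theorem closure_compl_preimage_of_isBlowup [IsLocallyNoetherian X] (hυ : IsBlowup υ (vanishingIdeal (⟨W, hW⟩ : Closeds X))) :
    closure (υ ⁻¹' W)ᶜ = Set.univ := by
  rw [← Set.preimage_compl]
  exact (dense_preimage_compl_of_isBlowup υ hW hυ).closure_eq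

/-- Point-centre instance (the point step of the chains): for a blow-up of the reduced closed point `x`, `closure (υ⁻¹(univ ∖ {x})) = univ`.
[OURS · L1 W4.5b · D4-0e] -/
theorem closure_preimage_univ_diff_singleton_of_isBlowup [IsLocallyNoetherian X] {x : X} (hx : IsClosed ({x} : Set X))
    (hυ : IsBlowup υ (vanishingIdeal (⟨{x}, hx⟩ : Closeds X))) : closure (υ ⁻¹' (Set.univ \ {x})) = Set.univ :=
  closure_preimage_univ_diff_of_isBlowup υ hx hυ

/-- More generally, any set containing the dense open `υ⁻¹(Wᶜ)` has closure `univ` — e.g. `υ⁻¹(S ∖ W)` for `S ⊇ Wᶜ`. [OURS · L1 W4.5b · D4-0e] -/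
theorem closure_eq_univ_of_preimage_compl_subset [IsLocallyNoetherian X] (hυ : IsBlowup υ (vanishingIdeal (⟨W, hW⟩ : Closeds X)))
    {A : Set X'} (hA : υ ⁻¹' Wᶜ ⊆ A) : closure A = Set.univ :=
  ((dense_preimage_compl_of_isBlowup υ hW hυ).mono hA).closure_eq

/-- **Noetherian-free variant**: if the blow-up `X′` is irreducible and the centre is not everything, `closure (υ⁻¹(univ ∖ W)) = univ` (a non-empty open subset
of an irreducible space is dense; `υ⁻¹(Wᶜ) ≠ ∅` because `υ` is an isomorphism over `Wᶜ ≠ ∅`). [OURS · L1 W4.5b · D4-0e] -/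
theorem closure_preimage_univ_diff_of_isBlowup_of_irreducibleSpace [IrreducibleSpace X'] (hυ : IsBlowup υ (vanishingIdeal (⟨W, hW⟩ : Closeds X)))
    (hWne : W ≠ Set.univ) : closure (υ ⁻¹' (Set.univ \ W)) = Set.univ := by
  rw [Set.sdiff_eq, Set.univ_inter]
  have hopen : IsOpen (υ ⁻¹' Wᶜ) := hW.isOpen_compl.preimage υ.continuous
  -- non-emptiness through the isomorphism `υ ∣_ Wᶜ : υ⁻¹(Wᶜ) ≅ Wᶜ`
  obtain ⟨x, hx⟩ : (Wᶜ : Set X).Nonempty := Set.nonempty_compl.mpr hWne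
  haveI : IsIso (υ ∣_ (⟨Wᶜ, hW.isOpen_compl⟩ : X.Opens)) := hυ.isIso_morphismRestrict_compl_of_vanishingIdeal
  obtain ⟨w, -⟩ := (υ ∣_ (⟨Wᶜ, hW.isOpen_compl⟩ : X.Opens)).homeomorph.surjective ⟨x, hx⟩
  have hne : (υ ⁻¹' Wᶜ).Nonempty := ⟨w.1, w.2⟩
  exact (hopen.dense hne).closure_eq

end Summit.ResolutionOfSingularities.ResolutionOfSingularities.Cruxes.EquisingularLiftNat.Sections

end
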